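import Literature.Geometry.Kaehler.ComplexTorusWeilTypeUnitaryGroup
import Literature.Geometry.Kaehler.ComplexTorusWeilHodgeCyclesIsogeny
import HarnessLib

/-!
# The Weil classes `W_K` are all Hodge or only `0` is; `W_K ⊆ B(X) ⟺ n_σ = n_σ̄ ⟺ Hg(X) ⊆ SL_K(V_X)`
# (Moonen–Zarhin 1998, (2), Criterion (4), Remark (6); Moonen–Zarhin 1999, (1.9))

Layer `Literature/Geometry/Kaehler`, namespace `Literature.Geometry.Kaehler.ComplexTorus`; lane
`lit-hodgefound` (Track 2 foundations library), Layer A4, self-proposed row «A4-40⁺ · Q72⁺ · (#2)⁺ —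
Moonen–Zarhin 1998 (2)/(4)/(6) + Moonen–Zarhin 1999 (1.9): the Weil classes `W_K` are all Hodge or only `0`
is; `W_K ⊆ B(X) ⟺ n_σ = n_σ̄ ⟺ Hg(X) ⊆ SL_K(V_X)`» of `run/shared/lean/pub/lit-hodgefound/SKELETON.md`.
Sequel of `ComplexTorusWeilTypeHodgeCycles.lean` (A4-40: `IsWeilType Φ α d n`, the Weil–Hodge cycles
`weilHodgeCycles Φ α d n = W_K ⊂ H^{2n}(X, ℚ)`, `⋀^{2n} U_± = slotEigenForms (ρ α) (±√-d) (2n)`,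
`isWeilType_of_weilHodgeCycle`), `ComplexTorusHodgeGroup.lean` (Q72: `hodgeGroup Φ = Hg(X)(ℝ)`, Thm. 7.2.4
`mem_hodgeClasses_iff_forall_mem_hodgeGroup`) and `ComplexTorusWeilTypeUnitaryGroup.lean` (row #2 FILE A:
the pointwise stabiliser `formsStabilizer Φ S`, `R(ℝ) = matCentralizer α ⊇ Hg(X)(ℝ)`, `SU_H(ℝ) =
weilSpecialUnitaryGroup Φ η α d n`, `IsWeilType.hodgeGroup_le_weilSpecialUnitaryGroup`). CONCRETE torus
level, model-free: `X = E/Φ(ℤ^ι)`, `K = ℚ(α) ⊂ End_ℚ(X)` imaginary quadratic (`α ∈ endAlgRat Φ`, `α² = -d`,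
`d > 0`), `dim X = 2n ≥ 1`, `H^k(X, ℂ) = Alt^k_ℝ(E; ℂ)`, `M ∈ SL(V_ℝ) = SL_ι(ℝ)` acting by pull-back along
`ρ(M) = Φ M Φ⁻¹` (`analyticRepReal Φ Φ M`); all groups through their REAL POINTS, as in Q72 / row #2.

## Sources, verbatim

B. J. J. Moonen, Yu. G. Zarhin, *Weil classes on abelian varieties*, J. reine angew. Math. 496 (1998)
83–92, held `paper:arxiv-alg-geom_9612017` (paragraph numbering of the arXiv version), p. 1:
* (1): "`W_F = W_F(X) := ⋀^r_F V_X` […] We call `W_F` the space of Weil classes with respect to `F`."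
* (2) (L62–L65): "Since `dim_F(W_F) = 1`, it readily follows that either all elements of `W_F` are Hodge
  classes, or `0 ∈ W_F` is the only Hodge class".
* (4) (L93–L97): "Criterion. If `n_σ = n_{σ'}` for all `σ ∈ Σ_F` then `W_F` consists entirely of Hodge
  classes; if `n_σ ≠ n_{σ'}` for some `σ ∈ Σ_F` then the zero class is the only Hodge class in `W_F`."
* (6) (L108–L113): "we have an inclusion `Hdg(X) ⊂ Gl_F(V_X)` and `Hdg(X)` acts on `W_F` through the
  `F`-linear determinant `det_F : Gl_F(V_X) → Res_{F/ℚ}(G_{m,F})`. […] hence contained in `Sl_F(V_X)`,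
  which means that `W_F` consists of Hodge classes."

B. J. J. Moonen, Yu. G. Zarhin, *Hodge classes on abelian varieties of low dimension*, Math. Ann. 315
(1999) 711–733, held `paper:arxiv-math_9901113`, (1.9) (p. 4, L110–L125): "The inclusion `K ⊂ End⁰(X)`
induces on `V_X` the structure of an `r`-dimensional `K`-vector space. The 1-dimensional `K`-vector space
`W_K = W_K(X) := ⋀^r_K V_X^∨` can be identified in a natural way with a subspace of `H^r(X, ℚ)`; we call
`W_K` the space of Weil classes w.r.t. `K`. […] It is known that either `W_K` consists entirely of Hodge
classes or `0 ∈ W_K` is the only Hodge class in `W_K`. […] `W_K` consists of Hodge classes if and only if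
`n_σ = n_σ̄` for all `σ ∈ Σ_K`. Note also that the Hodge Lie algebra is contained in the Lie algebra
`End_K(V_X)` of `K`-linear endomorphisms of `V_X` and that it acts on `W_K` through the `K`-linear trace
map `tr_K : End_K(V_X) → K`. In particular, `W_K` consists of Hodge classes precisely if
`hg(X) ⊆ sl_K(V_X)`."

## Rendering (theorems only; no definition, no named fact, net debt 0)

`K = ℚ(α)` imaginary quadratic, `r = 2 dim X/[K:ℚ] = dim X = 2n`, `Σ_K = {σ, σ̄}`, `σ(α) = √-d`;
`n_σ = dim_ℂ E₊` and `n_σ̄ = dim_ℂ E₋` are the dimensions of the `±√-d`-eigenspaces of `ρₐ(α)` on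
`T_{X,0} = E` (`WeilOperator.posEigenspace` / `negEigenspace`); `W_K = weilHodgeCycles Φ α d n` (A4-40: the
rational classes in `⋀^{2n} U₊ ⊕ ⋀^{2n} U₋ = W_K ⊗ ℂ`, `⋀^{2n} U₊ = ⋀^r_ℂ V_{ℂ,σ}^∨`, `⋀^{2n} U₋` its
conjugate); `B^n(X) = hodgeClasses Φ n`. The hypotheses are the EXPLICIT data `α ∈ End_ℚ(X)`, `d > 0`,
`α² = -d`, `n ≥ 1`, `dim_ℂ E = 2n` — NOT `IsWeilType` (whose extra field is the signature condition
`n_σ = n`).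
* §1 — "`dim_F(W_F) = 1`" WITHOUT the signature condition: `span_complex_weilHodgeCycles_of_sq`
  (`W_K ⊗ ℂ = ⋀^{2n} U₊ ⊕ ⋀^{2n} U₋`, by A4-40's rational projector `WeilOperator.span_inf_slotEigenForms_sup_eq`),
  `finrank_weilHodgeCycles_of_sq` (`dim_ℚ W_K = 2`), `weilHodgeCycles_ne_bot_of_sq`.
* §2 — (2) and the Criterion (4): **`weilHodgeCycles_le_hodgeClasses_or_inf_eq_bot`** (all of `W_K` is
  Hodge, or `W_K ∩ B^n = 0`), **`weilHodgeCycles_le_hodgeClasses_iff_finrank_posEigenspace_eq_finrank_negEigenspace`**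
  (`W_K ⊆ B^n ⟺ n_σ = n_σ̄`), `weilHodgeCycles_le_hodgeClasses_iff_isWeilType`,
  `weilHodgeCycles_inf_hodgeClasses_eq_bot_iff_not_isWeilType`.
* §3 — complex conjugation: `conjForm` maps `⋀^k U_c` onto `⋀^k U_{c̄}` and commutes with the (real) action
  of `SL(V_ℝ)`, so fixing `⋀^{2n} U₊` pointwise is the same as fixing `⋀^{2n} U₊ ⊕ ⋀^{2n} U₋`
  (`formsStabilizer_slotEigenForms_sup`).
* §4 — (6) / (1.9) in GROUP form on real points. "`Hdg(X) ⊂ Gl_F(V_X)`" is FILE A's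
  `hodgeGroup_le_matCentralizer`; "acts on `W_F` through the `F`-linear determinant":
  **`exists_smul_of_mem_matCentralizer`** — every `M ∈ R(ℝ)` (real, commuting with `α`) acts on the LINE
  `⋀^{2n} U₊` by a scalar `χ(M)` and on `⋀^{2n} U₋` by `χ̄(M)` (`χ = det_K ⊗_σ ℂ`, made explicit for Weil type
  in row #2 FILE B `IsWeilType.letterMatrix`); "`SL_K(V_X)`" is read, as in row #2's `SU_H`, as the kernel of
  `χ`, i.e. the pointwise stabiliser `formsStabilizer Φ (⋀^{2n} U₊)`. Then:
  `weilHodgeCycles_le_hodgeClasses_iff_hodgeGroup_le_formsStabilizer` (Thm. 7.2.4 on `W_K`: `W_K ⊆ B^n ⟺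
  Hg(X)(ℝ)` fixes `W_K` pointwise — no hypotheses), `formsStabilizer_weilHodgeCycles_eq`, and the MAIN
  **`weilHodgeCycles_le_hodgeClasses_iff_hodgeGroup_le_formsStabilizer_slotEigenForms`** ("`W_K` consists of
  Hodge classes precisely if `Hg(X) ⊆ SL_K(V_X)`"), `isWeilType_iff_hodgeGroup_le_formsStabilizer_slotEigenForms`,
  and, for any rational `(1,1)`-class `E` (e.g. a polarisation), **`isWeilType_iff_hodgeGroup_le_weilSpecialUnitaryGroup`**
  (`(X, K)` is of Weil type ⟺ `Hg(X) ⊆ SU_H` — the converse of row #2's containment).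

NOT here: Question Q2 of MZ98 (when the Weil classes are exceptional / not in `D^•(X)`); CM fields `F` other
than imaginary quadratic and odd `r` (the tree's carrier `weilHodgeCycles Φ α d n` is `K = ℚ(√-d)`,
`r = 2n`) — `-- TODO(general form): W_F for a CM field F ⊂ End⁰(X)`; the Lie-algebra statement itself
(`hg(X)`, `tr_K`) — the tree's Hodge group is the group of real points `hodgeGroup Φ`, and the statement is
rendered on it.

## References

* [MoonenZarhin1998WeilClasses] B. J. J. Moonen, Yu. G. Zarhin, *Weil classes on abelian varieties*,
  J. reine angew. Math. 496 (1998), (2), Criterion (4), Remark (6) (arXiv alg-geom/9612017 p. 1).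
* [MoonenZarhin1999LowDim] B. J. J. Moonen, Yu. G. Zarhin, *Hodge classes on abelian varieties of low
  dimension*, Math. Ann. 315 (1999), (1.9) (arXiv math/9901113 p. 4).
* [Lange2023AbelianVarietiesComplex] H. Lange, *Abelian Varieties over the Complex Numbers* (2023), §7.2.2
  Thm. 7.2.4, §7.2.4 Exercises (8), (9).
* [vanGeemen1994HodgeAV] B. van Geemen, *An introduction to the Hodge conjecture for abelian varieties*,
  LNM 1594 (1994), 4.9–4.10, 6.9–6.11.
-/

noncomputable section

open scoped ComplexConjugate
open Complex Function Module Matrix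
open Literature.Analysis.Complex Literature.Analysis.Complex.WeilOperator
open Literature.LinearAlgebra.Alternating (conjForm conjForm_apply)

namespace Literature.Geometry.Kaehler

namespace ComplexTorus

variable {ι : Type*} [Fintype ι] [DecidableEq ι] {E : Type*} [NormedAddCommGroup E] [NormedSpace ℂ E]
  (Φ : (ι → ℝ) ≃L[ℝ] E)

/-! ## §0 Plumbing -/

omit [DecidableEq ι] in
/-- `E` is finite-dimensional over `ℂ` (it is `ℝ^ι` over `ℝ`). [folklore] -/
private theorem wkh_finiteDimensional_complex (Φ : (ι → ℝ) ≃L[ℝ] E) : FiniteDimensional ℂ E :=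
  haveI : FiniteDimensional ℝ E := LinearEquiv.finiteDimensional Φ.toLinearEquiv
  Module.Finite.of_restrictScalars_finite ℝ ℂ E

omit [Fintype ι] [DecidableEq ι] in
/-- Pull-back commutes with complex scalars. [folklore] -/
private theorem wkh_smul_comp {k : ℕ} {F : Type*} [NormedAddCommGroup F] [NormedSpace ℝ F]
    (c : ℂ) (γ : E [⋀^Fin k]→L[ℝ] ℂ) (f : F →L[ℝ] E) :
    (c • γ).compContinuousLinearMap f = c • γ.compContinuousLinearMap f := by
  ext v; rfl

omit [Fintype ι] [DecidableEq ι] in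
/-- Conjugation of forms commutes with pull-back along a real-linear map. [folklore] -/
private theorem wkh_conjForm_comp {k : ℕ} {F : Type*} [NormedAddCommGroup F] [NormedSpace ℝ F]
    (γ : E [⋀^Fin k]→L[ℝ] ℂ) (f : F →L[ℝ] E) :
    conjForm (γ.compContinuousLinearMap f) = (conjForm γ).compContinuousLinearMap f := by
  ext v; rfl

omit [Fintype ι] [DecidableEq ι] in
/-- Conjugation of forms is injective (it is an involution). [folklore] -/
private theorem wkh_conjForm_eq_iff {k : ℕ} {γ δ : E [⋀^Fin k]→L[ℝ] ℂ} : conjForm γ = conjForm δ ↔ γ = δ := by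
  refine ⟨fun h ↦ ?_, fun h ↦ by rw [h]⟩
  rw [← LinearAlgebra.Alternating.conj_conj γ, h, LinearAlgebra.Alternating.conj_conj]

/-- `H^k(X, ℚ)` is stable under the pull-back by the RATIONAL endomorphism `(d + 1) + α ∈ End_ℚ(X)` — the
hypothesis of A4-40's rational projector, here for any `α ∈ End_ℚ(X)` (no signature, no `α² = -d`).
[cite: vanGeemen1994HodgeAV, 4.8–4.9 (`End(X)_ℚ` acts on `H^•(X, ℚ)` via `f^*`)] -/
theorem compContinuousLinearMap_shift_mem_rationalForms_of_mem_endAlgRat {α : Matrix ι ι ℚ}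
    (hα : α ∈ endAlgRat Φ) (d : ℕ) {k : ℕ} {γ : E [⋀^Fin k]→L[ℝ] ℂ} (hγ : γ ∈ rationalForms Φ k) :
    γ.compContinuousLinearMap ((shift d : ℝ) • ContinuousLinearMap.id ℝ E +
      (analyticRepHom Φ ⟨α, hα⟩).restrictScalars ℝ) ∈ rationalForms Φ k := by
  have hop : ((shift d : ℝ) • ContinuousLinearMap.id ℝ E +
      (analyticRepHom Φ ⟨α, hα⟩).restrictScalars ℝ) =
      analyticRepReal Φ Φ ((((shift d : ℚ)) • (1 : Matrix ι ι ℚ) + α).map (Rat.cast : ℚ → ℝ)) := by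
    rw [restrictScalars_analyticRepHom]
    have hmap : (((shift d : ℚ) • (1 : Matrix ι ι ℚ) + α).map (Rat.cast : ℚ → ℝ)) =
        (shift d : ℝ) • (1 : Matrix ι ι ℝ) + α.map (Rat.cast : ℚ → ℝ) := by
      ext i j
      simp [Matrix.one_apply, apply_ite (Rat.cast : ℚ → ℝ)]
    rw [hmap, analyticRepReal_add, analyticRepReal_smul, analyticRepReal_one]
  rw [hop]
  exact compContinuousLinearMap_analyticRepReal_ratCast_mem_rationalForms Φ _ hγ

/-! ## §1 `dim_F W_F = 1`: the Weil plane without the signature condition -/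

section Plane

variable {Φ} {α : Matrix ι ι ℚ} {d n : ℕ}

/-- **`W_K ⊗ ℂ = ⋀^{2n} U₊ ⊕ ⋀^{2n} U₋` for ANY `(X, K)`** (`K = ℚ(α)`, `α² = -d < 0`, `dim X = 2n ≥ 1`; no
signature condition): the complex span of the Weil classes is the whole plane `⋀^r_ℂ V_{ℂ,σ} ⊕ ⋀^r_ℂ V_{ℂ,σ̄}`
("`W_F ⊗ ℂ = ⊕_σ ⋀^r_ℂ V_{ℂ,σ}`"), by A4-40's rational projector. [cite: MoonenZarhin1998WeilClasses, (3) (the display `W_F ⊗ ℂ = ⊕_σ ⋀^r_ℂ V_{ℂ,σ}`)]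
[cite: vanGeemen1994HodgeAV, 4.9 and proof of Lemma 5.2 (6)] -/
theorem span_complex_weilHodgeCycles_of_sq (hα : α ∈ endAlgRat Φ) (hd : 0 < d)
    (hsq : α * α = -((d : ℚ) • 1)) (hn : 0 < n) (hE : finrank ℂ E = 2 * n) :
    Submodule.span ℂ (weilHodgeCycles Φ α d n : Set (E [⋀^Fin (2 * n)]→L[ℝ] ℂ)) =
      slotEigenForms (analyticRepReal Φ Φ (α.map (Rat.cast : ℚ → ℝ))) (sqrtNeg d) (2 * n) ⊔
        slotEigenForms (analyticRepReal Φ Φ (α.map (Rat.cast : ℚ → ℝ))) (-sqrtNeg d) (2 * n) := by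
  haveI := wkh_finiteDimensional_complex Φ
  have hmain := span_inf_slotEigenForms_sup_eq hd (analyticRepHom_sq Φ hα hsq)
    (idxEquiv (Nat.cast_pos.2 hd) (analyticRepHom_sq_real Φ hα hsq) hE) (by omega) (rationalForms Φ (2 * n))
    (span_complex_rationalForms_eq_top Φ (2 * n))
    fun γ hγ ↦ compContinuousLinearMap_shift_mem_rationalForms_of_mem_endAlgRat Φ hα d hγ
  rw [restrictScalars_analyticRepHom] at hmain
  exact hmain

/-- **`dim_ℚ W_K = 2`, i.e. "`dim_F(W_F) = 1`"**, for any `(X, K)` as above (no signature condition).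
[cite: MoonenZarhin1998WeilClasses, (1)–(2) ("The 1-dimensional `F`-vector space `W_F`"; "Since `dim_F(W_F) = 1`")]
[cite: MoonenZarhin1999LowDim, (1.9) ("The 1-dimensional `K`-vector space `W_K`")] -/
theorem finrank_weilHodgeCycles_of_sq (hα : α ∈ endAlgRat Φ) (hd : 0 < d) (hsq : α * α = -((d : ℚ) • 1))
    (hn : 0 < n) (hE : finrank ℂ E = 2 * n) : finrank ℚ (weilHodgeCycles Φ α d n) = 2 := by
  haveI := wkh_finiteDimensional_complex Φ
  rw [← finrank_span_complex_eq Φ (weilHodgeCycles_le_rationalForms Φ α d n),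
    span_complex_weilHodgeCycles_of_sq hα hd hsq hn hE, ← restrictScalars_analyticRepHom Φ hα]
  exact finrank_slotEigenForms_sup_eq_two (Nat.cast_pos.2 hd) (analyticRepHom_sq_real Φ hα hsq) hE (by omega)

/-- `W_K ≠ 0` for any `(X, K)` as above. [cite: MoonenZarhin1998WeilClasses, (2) ("Since `dim_F(W_F) = 1`")] -/
theorem weilHodgeCycles_ne_bot_of_sq (hα : α ∈ endAlgRat Φ) (hd : 0 < d) (hsq : α * α = -((d : ℚ) • 1))
    (hn : 0 < n) (hE : finrank ℂ E = 2 * n) : weilHodgeCycles Φ α d n ≠ ⊥ := by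
  intro hb
  have h2 := finrank_weilHodgeCycles_of_sq hα hd hsq hn hE
  rw [hb, finrank_bot] at h2
  exact absurd h2 (by norm_num)

/-- There is a non-zero Weil class. [cite: MoonenZarhin1998WeilClasses, (2)] -/
theorem exists_mem_weilHodgeCycles_ne_zero (hα : α ∈ endAlgRat Φ) (hd : 0 < d)
    (hsq : α * α = -((d : ℚ) • 1)) (hn : 0 < n) (hE : finrank ℂ E = 2 * n) :
    ∃ γ ∈ weilHodgeCycles Φ α d n, γ ≠ 0 :=
  Submodule.exists_mem_ne_zero_of_ne_bot (weilHodgeCycles_ne_bot_of_sq hα hd hsq hn hE)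

/-! ## §2 (2) and the Criterion (4): all of `W_K` is Hodge, or only `0`; `W_K ⊆ B ⟺ n_σ = n_σ̄` -/

/-- **Moonen–Zarhin (2) / (1.9): "either `W_K` consists entirely of Hodge classes or `0 ∈ W_K` is the only
Hodge class in `W_K`"** — if one non-zero Weil class is Hodge then `(X, K)` is of Weil type (A4-40
`isWeilType_of_weilHodgeCycle`, Deligne's Prop. 4.4) and all of `W_K` is Hodge.
[cite: MoonenZarhin1998WeilClasses, (2)] [cite: MoonenZarhin1999LowDim, (1.9)] -/
theorem weilHodgeCycles_le_hodgeClasses_or_inf_eq_bot (hα : α ∈ endAlgRat Φ) (hd : 0 < d)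
    (hsq : α * α = -((d : ℚ) • 1)) (hn : 0 < n) (hE : finrank ℂ E = 2 * n) :
    weilHodgeCycles Φ α d n ≤ hodgeClasses Φ n ∨ weilHodgeCycles Φ α d n ⊓ hodgeClasses Φ n = ⊥ := by
  haveI := wkh_finiteDimensional_complex Φ
  by_cases h : weilHodgeCycles Φ α d n ⊓ hodgeClasses Φ n = ⊥
  · exact Or.inr h
  · obtain ⟨γ, hγ, hγ0⟩ := Submodule.exists_mem_ne_zero_of_ne_bot h
    exact Or.inl (isWeilType_of_weilHodgeCycle Φ hα hd hn hsq hE (Submodule.mem_inf.1 hγ).1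
      (Submodule.mem_inf.1 hγ).2 hγ0).weilHodgeCycles_le_hodgeClasses

/-- `W_K ⊆ B^n(X)` iff `(X, K)` is of Weil type (signature `(n, n)`). [cite: MoonenZarhin1998WeilClasses, Criterion (4)]
[cite: vanGeemen1994HodgeAV, 4.10] -/
theorem weilHodgeCycles_le_hodgeClasses_iff_isWeilType (hα : α ∈ endAlgRat Φ) (hd : 0 < d)
    (hsq : α * α = -((d : ℚ) • 1)) (hn : 0 < n) (hE : finrank ℂ E = 2 * n) :
    weilHodgeCycles Φ α d n ≤ hodgeClasses Φ n ↔ IsWeilType Φ α d n := by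
  haveI := wkh_finiteDimensional_complex Φ
  refine ⟨fun h ↦ ?_, fun h ↦ h.weilHodgeCycles_le_hodgeClasses⟩
  obtain ⟨γ, hγ, hγ0⟩ := exists_mem_weilHodgeCycles_ne_zero hα hd hsq hn hE
  exact isWeilType_of_weilHodgeCycle Φ hα hd hn hsq hE hγ (h hγ) hγ0

/-- `W_K ⊆ B^n(X)` iff `n_σ = n` (`= r/2`). [cite: MoonenZarhin1998WeilClasses, Criterion (4)] -/
theorem weilHodgeCycles_le_hodgeClasses_iff_finrank_posEigenspace (hα : α ∈ endAlgRat Φ) (hd : 0 < d)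
    (hsq : α * α = -((d : ℚ) • 1)) (hn : 0 < n) (hE : finrank ℂ E = 2 * n) :
    weilHodgeCycles Φ α d n ≤ hodgeClasses Φ n ↔
      finrank ℂ (posEigenspace (analyticRepHom Φ ⟨α, hα⟩) d) = n := by
  rw [weilHodgeCycles_le_hodgeClasses_iff_isWeilType hα hd hsq hn hE]
  exact ⟨fun h ↦ h.finrank_posEigenspace, fun h ↦ ⟨hα, hsq, hd, hn, hE, h⟩⟩

/-- **Moonen–Zarhin's Criterion (4) / (1.9): "`W_K` consists of Hodge classes if and only if `n_σ = n_σ̄`"**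
(`n_σ`, `n_σ̄` the multiplicities of the two embeddings `σ, σ̄ : K → ℂ` on `T_{X,0}`, i.e. the dimensions of
the `±√-d`-eigenspaces of `ρₐ(α)`). [cite: MoonenZarhin1998WeilClasses, Criterion (4)] [cite: MoonenZarhin1999LowDim, (1.9)] -/
theorem weilHodgeCycles_le_hodgeClasses_iff_finrank_posEigenspace_eq_finrank_negEigenspace
    (hα : α ∈ endAlgRat Φ) (hd : 0 < d) (hsq : α * α = -((d : ℚ) • 1)) (hn : 0 < n)
    (hE : finrank ℂ E = 2 * n) :
    weilHodgeCycles Φ α d n ≤ hodgeClasses Φ n ↔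
      finrank ℂ (posEigenspace (analyticRepHom Φ ⟨α, hα⟩) d) =
        finrank ℂ (negEigenspace (analyticRepHom Φ ⟨α, hα⟩) d) := by
  haveI := wkh_finiteDimensional_complex Φ
  rw [weilHodgeCycles_le_hodgeClasses_iff_finrank_posEigenspace hα hd hsq hn hE]
  have hs := finrank_posEigenspace_add_finrank_negEigenspace (Nat.cast_pos.2 hd) (analyticRepHom_sq_real Φ hα hsq)
  rw [hE] at hs
  omega

/-- The other branch: `W_K ∩ B^n(X) = 0` iff `(X, K)` is NOT of Weil type (`n_σ ≠ n_σ̄`).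
[cite: MoonenZarhin1998WeilClasses, Criterion (4) ("if `n_σ ≠ n_{σ'}` for some `σ` then the zero class is the only Hodge class in `W_F`")] -/
theorem weilHodgeCycles_inf_hodgeClasses_eq_bot_iff_not_isWeilType (hα : α ∈ endAlgRat Φ) (hd : 0 < d)
    (hsq : α * α = -((d : ℚ) • 1)) (hn : 0 < n) (hE : finrank ℂ E = 2 * n) :
    weilHodgeCycles Φ α d n ⊓ hodgeClasses Φ n = ⊥ ↔ ¬IsWeilType Φ α d n := by
  haveI := wkh_finiteDimensional_complex Φ
  rw [← weilHodgeCycles_le_hodgeClasses_iff_isWeilType hα hd hsq hn hE]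
  constructor
  · intro h hle
    obtain ⟨γ, hγ, hγ0⟩ := exists_mem_weilHodgeCycles_ne_zero hα hd hsq hn hE
    have hγ' : γ ∈ weilHodgeCycles Φ α d n ⊓ hodgeClasses Φ n := Submodule.mem_inf.2 ⟨hγ, hle hγ⟩
    rw [h] at hγ'
    exact hγ0 ((Submodule.mem_bot ℚ).1 hγ')
  · intro h
    exact (weilHodgeCycles_le_hodgeClasses_or_inf_eq_bot hα hd hsq hn hE).resolve_left h

end Plane

/-! ## §3 Complex conjugation: `conj ⋀^k U_c = ⋀^k U_{c̄}`, and real groups fix both or neither -/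

omit [Fintype ι] [DecidableEq ι] in
/-- **`conj (⋀^k U_c) ⊆ ⋀^k U_{c̄}`**: the conjugate of a form on which the REAL operator `T` acts by `c` in
every slot is a form on which `T` acts by `c̄` ("`V_ℂ = W ⊕ W̄`"; `⋀^r V_{ℂ,σ̄} = conj ⋀^r V_{ℂ,σ}`).
[cite: vanGeemen1994HodgeAV, proof of 6.10 ("`V_ℂ = W ⊕ W̄`")] [cite: MoonenZarhin1998WeilClasses, (3)] -/
theorem _root_.Literature.Analysis.Complex.conjForm_mem_slotEigenForms {T : E →L[ℝ] E} {c : ℂ} {k : ℕ}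
    {γ : E [⋀^Fin k]→L[ℝ] ℂ} (hγ : γ ∈ slotEigenForms T c k) : conjForm γ ∈ slotEigenForms T (conj c) k := by
  rw [mem_slotEigenForms_iff] at hγ ⊢
  intro v i
  rw [conjForm_apply, conjForm_apply, hγ, map_mul]

omit [Fintype ι] [DecidableEq ι] in
/-- `conj (⋀^k U_c) = ⋀^k U_{c̄}` as sets of forms. [cite: vanGeemen1994HodgeAV, proof of 6.10 ("`V_ℂ = W ⊕ W̄`")] -/
theorem _root_.Literature.Analysis.Complex.conjForm_image_slotEigenForms (T : E →L[ℝ] E) (c : ℂ) (k : ℕ) :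
    conjForm '' (slotEigenForms T c k : Set (E [⋀^Fin k]→L[ℝ] ℂ)) = slotEigenForms T (conj c) k := by
  refine Set.Subset.antisymm (Set.image_subset_iff.2 fun γ hγ ↦ conjForm_mem_slotEigenForms hγ) fun δ hδ ↦ ?_
  refine ⟨conjForm δ, ?_, LinearAlgebra.Alternating.conj_conj δ⟩
  have h := conjForm_mem_slotEigenForms hδ
  rwa [Complex.conj_conj] at h

/-- **A real group fixes a set of forms pointwise iff it fixes the conjugate set**: conjugation commutes
with the pull-back along the REAL maps `ρ(M)`, `M ∈ SL(V_ℝ)`. [cite: vanGeemen1994HodgeAV, proof of 6.10 (both `W` and `W̄` are invariant)] -/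
theorem formsStabilizer_conjForm_image {k : ℕ} (S : Set (E [⋀^Fin k]→L[ℝ] ℂ)) :
    formsStabilizer Φ (conjForm '' S) = formsStabilizer Φ S := by
  ext M
  simp only [mem_formsStabilizer_iff, Set.forall_mem_image, ← wkh_conjForm_comp, wkh_conjForm_eq_iff]

/-- Fixing a union pointwise is fixing both parts. [cite: vanGeemen1994HodgeAV, 6.5 (proof)] -/
theorem formsStabilizer_union {k : ℕ} (S T : Set (E [⋀^Fin k]→L[ℝ] ℂ)) :
    formsStabilizer Φ (S ∪ T) = formsStabilizer Φ S ⊓ formsStabilizer Φ T := by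
  ext M
  simp only [mem_formsStabilizer_iff, Subgroup.mem_inf, Set.mem_union]
  exact ⟨fun h ↦ ⟨fun γ hγ ↦ h γ (Or.inl hγ), fun γ hγ ↦ h γ (Or.inr hγ)⟩,
    fun h γ hγ ↦ hγ.elim (h.1 γ) (h.2 γ)⟩

/-- Fixing a sum of subspaces pointwise is fixing both summands. [cite: vanGeemen1994HodgeAV, 6.5 and 6.7 (linearity)] -/
theorem formsStabilizer_sup {k : ℕ} (W₁ W₂ : Submodule ℂ (E [⋀^Fin k]→L[ℝ] ℂ)) :
    formsStabilizer Φ ((W₁ ⊔ W₂ : Submodule ℂ (E [⋀^Fin k]→L[ℝ] ℂ)) : Set (E [⋀^Fin k]→L[ℝ] ℂ)) =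
      formsStabilizer Φ (W₁ : Set (E [⋀^Fin k]→L[ℝ] ℂ)) ⊓ formsStabilizer Φ (W₂ : Set (E [⋀^Fin k]→L[ℝ] ℂ)) := by
  have h : Submodule.span ℂ ((W₁ : Set (E [⋀^Fin k]→L[ℝ] ℂ)) ∪ W₂) = W₁ ⊔ W₂ := by
    rw [Submodule.span_union, Submodule.span_eq, Submodule.span_eq]
  rw [← h, formsStabilizer_span, formsStabilizer_union]

/-- **Fixing `⋀^k U₋ = conj ⋀^k U₊` pointwise is fixing `⋀^k U₊` pointwise** (real group, `-√-d = conj √-d`).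
[cite: vanGeemen1994HodgeAV, proof of 6.10 ("`r_{B,C} ↦ (B + √-d C, B - √-d C)`" on `W ⊕ W̄`)] -/
theorem formsStabilizer_slotEigenForms_neg (T : E →L[ℝ] E) (d : ℝ) (k : ℕ) :
    formsStabilizer Φ (slotEigenForms T (-sqrtNeg d) k : Set (E [⋀^Fin k]→L[ℝ] ℂ)) =
      formsStabilizer Φ (slotEigenForms T (sqrtNeg d) k : Set (E [⋀^Fin k]→L[ℝ] ℂ)) := by
  rw [← conj_sqrtNeg, ← conjForm_image_slotEigenForms, formsStabilizer_conjForm_image]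

/-- **Fixing the plane `⋀^k U₊ ⊕ ⋀^k U₋` pointwise is fixing the line `⋀^k U₊` pointwise** (real group).
[cite: vanGeemen1994HodgeAV, proof of 6.10] [cite: MoonenZarhin1998WeilClasses, (6)] -/
theorem formsStabilizer_slotEigenForms_sup (T : E →L[ℝ] E) (d : ℝ) (k : ℕ) :
    formsStabilizer Φ ((slotEigenForms T (sqrtNeg d) k ⊔ slotEigenForms T (-sqrtNeg d) k :
        Submodule ℂ (E [⋀^Fin k]→L[ℝ] ℂ)) : Set (E [⋀^Fin k]→L[ℝ] ℂ)) =
      formsStabilizer Φ (slotEigenForms T (sqrtNeg d) k : Set (E [⋀^Fin k]→L[ℝ] ℂ)) := by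
  rw [formsStabilizer_sup, formsStabilizer_slotEigenForms_neg, inf_idem]

/-! ## §4 (6) / (1.9): `Hg(X) ⊂ GL_K(V_X)` acts on `W_K` through a character; `W_K ⊆ B ⟺ Hg(X) ⊆ SL_K(V_X)` -/

section Group

variable {Φ} {α : Matrix ι ι ℚ} {d n : ℕ}

/-- `R(ℝ)` commutes with `ρ(α)`: `ρ(M) ρ(α) = ρ(α) ρ(M)` for `M (α ⊗ 1) = (α ⊗ 1) M`.
[cite: vanGeemen1994HodgeAV, 6.9 ("`R(L)` consists of the invertible `L`-linear maps commuting with `(√-d)^* ⊗ 1`")] -/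
theorem analyticRepReal_comm_of_mem_matCentralizer {M : SpecialLinearGroup ι ℝ} (hM : M ∈ matCentralizer α)
    (v : E) : analyticRepReal Φ Φ M.1 (analyticRepReal Φ Φ (α.map (Rat.cast : ℚ → ℝ)) v) =
      analyticRepReal Φ Φ (α.map (Rat.cast : ℚ → ℝ)) (analyticRepReal Φ Φ M.1 v) := by
  rw [← ContinuousLinearMap.comp_apply, ← analyticRepReal_mul Φ Φ Φ, mem_matCentralizer_iff.1 hM,
    analyticRepReal_mul Φ Φ Φ, ContinuousLinearMap.comp_apply]

/-- `R(ℝ)` preserves each `⋀^k U_c` ("both `W` and `W̄` are invariant subspaces").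
[cite: vanGeemen1994HodgeAV, proof of 6.10] -/
theorem compContinuousLinearMap_mem_slotEigenForms_of_mem_matCentralizer {M : SpecialLinearGroup ι ℝ}
    (hM : M ∈ matCentralizer α) {c : ℂ} {k : ℕ} {γ : E [⋀^Fin k]→L[ℝ] ℂ}
    (hγ : γ ∈ slotEigenForms (analyticRepReal Φ Φ (α.map (Rat.cast : ℚ → ℝ))) c k) :
    γ.compContinuousLinearMap (analyticRepReal Φ Φ M.1) ∈
      slotEigenForms (analyticRepReal Φ Φ (α.map (Rat.cast : ℚ → ℝ))) c k :=
  compContinuousLinearMap_mem_slotEigenForms (analyticRepReal_comm_of_mem_matCentralizer hM) hγ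

/-- **Moonen–Zarhin (6) / (1.9), group form on real points: `GL_K(V)(ℝ) = R(ℝ)` acts on the Weil classes
through a CHARACTER** — every `M ∈ R(ℝ)` acts on the line `⋀^{2n} U₊ = ⋀^r_ℂ V_{ℂ,σ}^∨` by a scalar `χ(M)` and
on `⋀^{2n} U₋` by `χ̄(M)` ("`Hdg(X) ⊂ Gl_F(V_X)` and `Hdg(X)` acts on `W_F` through the `F`-linear determinant
`det_F : Gl_F(V_X) → Res_{F/ℚ}(G_{m,F})`"; `χ = σ ∘ det_K`, cf. row #2 FILE B `IsWeilType.letterMatrix`).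
[cite: MoonenZarhin1998WeilClasses, (6)] [cite: MoonenZarhin1999LowDim, (1.9) ("acts on `W_K` through the `K`-linear trace map")] -/
theorem exists_smul_of_mem_matCentralizer (hα : α ∈ endAlgRat Φ) (hd : 0 < d)
    (hsq : α * α = -((d : ℚ) • 1)) {k : ℕ} (hE : finrank ℂ E = k) {M : SpecialLinearGroup ι ℝ}
    (hM : M ∈ matCentralizer α) :
    ∃ c : ℂ, (∀ γ ∈ slotEigenForms (analyticRepReal Φ Φ (α.map (Rat.cast : ℚ → ℝ))) (sqrtNeg d) k,
        γ.compContinuousLinearMap (analyticRepReal Φ Φ M.1) = c • γ) ∧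
      ∀ γ ∈ slotEigenForms (analyticRepReal Φ Φ (α.map (Rat.cast : ℚ → ℝ))) (-sqrtNeg d) k,
        γ.compContinuousLinearMap (analyticRepReal Φ Φ M.1) = conj c • γ := by
  haveI := wkh_finiteDimensional_complex Φ
  have hd' : (0 : ℝ) < d := Nat.cast_pos.2 hd
  have hT := analyticRepHom_sq_real Φ hα hsq
  set Ω := plusForm hd' hT (idxEquiv hd' hT hE) with hΩ
  have hL : slotEigenForms (analyticRepReal Φ Φ (α.map (Rat.cast : ℚ → ℝ))) (sqrtNeg d) k = ℂ ∙ Ω := by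
    rw [← restrictScalars_analyticRepHom Φ hα]
    exact slotEigenForms_eq_span_plusForm hd' hT _
  have hΩmem : Ω ∈ slotEigenForms (analyticRepReal Φ Φ (α.map (Rat.cast : ℚ → ℝ))) (sqrtNeg d) k := by
    rw [hL]; exact Submodule.mem_span_singleton_self Ω
  have hΩM := compContinuousLinearMap_mem_slotEigenForms_of_mem_matCentralizer hM hΩmem
  rw [hL, Submodule.mem_span_singleton] at hΩM
  obtain ⟨c, hc⟩ := hΩM
  have hplus : ∀ γ ∈ slotEigenForms (analyticRepReal Φ Φ (α.map (Rat.cast : ℚ → ℝ))) (sqrtNeg d) k,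
      γ.compContinuousLinearMap (analyticRepReal Φ Φ M.1) = c • γ := by
    intro γ hγ
    rw [hL, Submodule.mem_span_singleton] at hγ
    obtain ⟨a, rfl⟩ := hγ
    rw [wkh_smul_comp, ← hc, smul_comm]
  refine ⟨c, hplus, fun γ hγ ↦ ?_⟩
  have hγ' : conjForm γ ∈ slotEigenForms (analyticRepReal Φ Φ (α.map (Rat.cast : ℚ → ℝ))) (sqrtNeg d) k := by
    have h := conjForm_mem_slotEigenForms hγ
    rwa [map_neg, conj_sqrtNeg, neg_neg] at h
  have h := hplus _ hγ'
  rw [← wkh_conjForm_comp, ← wkh_conjForm_eq_iff, LinearAlgebra.Alternating.conj_conj,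
    LinearAlgebra.Alternating.conj_smul, LinearAlgebra.Alternating.conj_conj] at h
  exact h

/-- In particular `Hg(X)(ℝ) ⊂ R(ℝ)` acts on `⋀^{2n} U₊`, `⋀^{2n} U₋` through a character and its conjugate.
[cite: MoonenZarhin1998WeilClasses, (6)] [cite: MoonenZarhin1999LowDim, (1.9)] -/
theorem exists_smul_of_mem_hodgeGroup (hα : α ∈ endAlgRat Φ) (hd : 0 < d) (hsq : α * α = -((d : ℚ) • 1))
    {k : ℕ} (hE : finrank ℂ E = k) {M : SpecialLinearGroup ι ℝ} (hM : M ∈ hodgeGroup Φ) :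
    ∃ c : ℂ, (∀ γ ∈ slotEigenForms (analyticRepReal Φ Φ (α.map (Rat.cast : ℚ → ℝ))) (sqrtNeg d) k,
        γ.compContinuousLinearMap (analyticRepReal Φ Φ M.1) = c • γ) ∧
      ∀ γ ∈ slotEigenForms (analyticRepReal Φ Φ (α.map (Rat.cast : ℚ → ℝ))) (-sqrtNeg d) k,
        γ.compContinuousLinearMap (analyticRepReal Φ Φ M.1) = conj c • γ :=
  exists_smul_of_mem_matCentralizer hα hd hsq hE (hodgeGroup_le_matCentralizer Φ hα hM)

variable (Φ) in
/-- **Thm. 7.2.4 on `W_K`: `W_K ⊆ B^n(X)` iff `Hg(X)(ℝ)` fixes `W_K` pointwise** (`B^n = H^{2n}(X, ℚ)^{Hg(X)}`;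
no hypothesis on `α, d, n`). [cite: Lange2023AbelianVarietiesComplex, §7.2.2 Thm. 7.2.4] [cite: MoonenZarhin1998WeilClasses, (6)] -/
theorem weilHodgeCycles_le_hodgeClasses_iff_hodgeGroup_le_formsStabilizer (α : Matrix ι ι ℚ) (d n : ℕ) :
    weilHodgeCycles Φ α d n ≤ hodgeClasses Φ n ↔
      hodgeGroup Φ ≤ formsStabilizer Φ (weilHodgeCycles Φ α d n : Set (E [⋀^Fin (2 * n)]→L[ℝ] ℂ)) := by
  constructor
  · intro h M hM γ hγ
    exact compContinuousLinearMap_eq_of_mem_hodgeGroup Φ (h hγ) hM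
  · intro h γ hγ
    exact (mem_hodgeClasses_iff_forall_mem_hodgeGroup Φ).2
      ⟨weilHodgeCycles_le_rationalForms Φ α d n hγ, fun M hM ↦ h hM γ hγ⟩

/-- **The pointwise stabiliser of `W_K` in `SL(V_ℝ)` is the pointwise stabiliser of the line `⋀^{2n} U₊`**
(`W_K ⊗ ℂ = ⋀^{2n} U₊ ⊕ ⋀^{2n} U₋`, linearity, conjugation). [cite: MoonenZarhin1998WeilClasses, (6)]
[cite: vanGeemen1994HodgeAV, 6.7 and proof of 6.10] -/
theorem formsStabilizer_weilHodgeCycles_eq (hα : α ∈ endAlgRat Φ) (hd : 0 < d) (hsq : α * α = -((d : ℚ) • 1))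
    (hn : 0 < n) (hE : finrank ℂ E = 2 * n) :
    formsStabilizer Φ (weilHodgeCycles Φ α d n : Set (E [⋀^Fin (2 * n)]→L[ℝ] ℂ)) =
      formsStabilizer Φ (slotEigenForms (analyticRepReal Φ Φ (α.map (Rat.cast : ℚ → ℝ))) (sqrtNeg d) (2 * n) :
        Set (E [⋀^Fin (2 * n)]→L[ℝ] ℂ)) := by
  rw [← formsStabilizer_span, span_complex_weilHodgeCycles_of_sq hα hd hsq hn hE,
    formsStabilizer_slotEigenForms_sup]

/-- **Moonen–Zarhin (6) / (1.9), MAIN: "`W_K` consists of Hodge classes precisely if `Hg(X) ⊆ SL_K(V_X)`"**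
— group form on real points: `W_K ⊆ B^n(X)` iff `Hg(X)(ℝ)` (`⊂ R(ℝ) = GL_K(V)(ℝ)`, acting on the line
`⋀^{2n} U₊ = ⋀^r_{K ⊗_σ ℂ} V_ℂ^∨` through `χ = σ ∘ det_K`) acts trivially on `⋀^{2n} U₊`, i.e. lies in the
kernel of `χ`. [cite: MoonenZarhin1998WeilClasses, (6) ("contained in `Sl_F(V_X)`, which means that `W_F` consists of Hodge classes")]
[cite: MoonenZarhin1999LowDim, (1.9) ("`W_K` consists of Hodge classes precisely if `hg(X) ⊆ sl_K(V_X)`")] -/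
theorem weilHodgeCycles_le_hodgeClasses_iff_hodgeGroup_le_formsStabilizer_slotEigenForms
    (hα : α ∈ endAlgRat Φ) (hd : 0 < d) (hsq : α * α = -((d : ℚ) • 1)) (hn : 0 < n)
    (hE : finrank ℂ E = 2 * n) :
    weilHodgeCycles Φ α d n ≤ hodgeClasses Φ n ↔
      hodgeGroup Φ ≤ formsStabilizer Φ
        (slotEigenForms (analyticRepReal Φ Φ (α.map (Rat.cast : ℚ → ℝ))) (sqrtNeg d) (2 * n) :
          Set (E [⋀^Fin (2 * n)]→L[ℝ] ℂ)) := by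
  rw [weilHodgeCycles_le_hodgeClasses_iff_hodgeGroup_le_formsStabilizer Φ,
    formsStabilizer_weilHodgeCycles_eq hα hd hsq hn hE]

/-- Equivalently with `⋀^{2n} U₋` (`σ̄` in place of `σ`). [cite: MoonenZarhin1998WeilClasses, (6)] -/
theorem weilHodgeCycles_le_hodgeClasses_iff_hodgeGroup_le_formsStabilizer_slotEigenForms_neg
    (hα : α ∈ endAlgRat Φ) (hd : 0 < d) (hsq : α * α = -((d : ℚ) • 1)) (hn : 0 < n)
    (hE : finrank ℂ E = 2 * n) :
    weilHodgeCycles Φ α d n ≤ hodgeClasses Φ n ↔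
      hodgeGroup Φ ≤ formsStabilizer Φ
        (slotEigenForms (analyticRepReal Φ Φ (α.map (Rat.cast : ℚ → ℝ))) (-sqrtNeg d) (2 * n) :
          Set (E [⋀^Fin (2 * n)]→L[ℝ] ℂ)) := by
  rw [weilHodgeCycles_le_hodgeClasses_iff_hodgeGroup_le_formsStabilizer_slotEigenForms hα hd hsq hn hE,
    formsStabilizer_slotEigenForms_neg]

/-- **`(X, K)` is of Weil type (`n_σ = n_σ̄`) iff `Hg(X) ⊆ SL_K(V_X)`** (real points, `SL_K` read on `⋀^{2n} U₊`).
[cite: MoonenZarhin1998WeilClasses, Criterion (4) and (6)] [cite: MoonenZarhin1999LowDim, (1.9)] -/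
theorem isWeilType_iff_hodgeGroup_le_formsStabilizer_slotEigenForms (hα : α ∈ endAlgRat Φ) (hd : 0 < d)
    (hsq : α * α = -((d : ℚ) • 1)) (hn : 0 < n) (hE : finrank ℂ E = 2 * n) :
    IsWeilType Φ α d n ↔
      hodgeGroup Φ ≤ formsStabilizer Φ
        (slotEigenForms (analyticRepReal Φ Φ (α.map (Rat.cast : ℚ → ℝ))) (sqrtNeg d) (2 * n) :
          Set (E [⋀^Fin (2 * n)]→L[ℝ] ℂ)) := by
  rw [← weilHodgeCycles_le_hodgeClasses_iff_isWeilType hα hd hsq hn hE,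
    weilHodgeCycles_le_hodgeClasses_iff_hodgeGroup_le_formsStabilizer_slotEigenForms hα hd hsq hn hE]

/-- **`(X, K)` is of Weil type iff `Hg(X) ⊆ SU_H`** for any rational `(1,1)`-class `E` (e.g. a polarisation):
the converse of row #2's `IsWeilType.hodgeGroup_le_weilSpecialUnitaryGroup` (`Hg(X)(ℝ) ⊆ U_H(ℝ)` always —
it centralises `α` and preserves `E` — so `Hg ⊆ SU_H` is exactly "`Hg` acts trivially on `⋀^{2n} U₊`").
[cite: MoonenZarhin1998WeilClasses, (6)] [cite: Lange2023AbelianVarietiesComplex, §7.2.4 Exercise (8)]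
[cite: vanGeemen1994HodgeAV, 6.9 and proof of 6.11 (first step)] -/
theorem isWeilType_iff_hodgeGroup_le_weilSpecialUnitaryGroup (hα : α ∈ endAlgRat Φ) (hd : 0 < d)
    (hsq : α * α = -((d : ℚ) • 1)) (hn : 0 < n) (hE : finrank ℂ E = 2 * n) {η : E [⋀^Fin 2]→L[ℝ] ℝ}
    (hη : ofRealForm η ∈ hodgeClasses Φ 1) :
    IsWeilType Φ α d n ↔ hodgeGroup Φ ≤ weilSpecialUnitaryGroup Φ η α d n := by
  refine ⟨fun h ↦ h.hodgeGroup_le_weilSpecialUnitaryGroup hη, fun h ↦ ?_⟩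
  exact (isWeilType_iff_hodgeGroup_le_formsStabilizer_slotEigenForms hα hd hsq hn hE).2
    (h.trans inf_le_right)

/-- `W_K ⊆ B^n(X)` iff `Hg(X) ⊆ SU_H` (any rational `(1,1)`-class `E`). [cite: MoonenZarhin1998WeilClasses, (6)]
[cite: Lange2023AbelianVarietiesComplex, §7.2.4 Exercises (8), (9)] -/
theorem weilHodgeCycles_le_hodgeClasses_iff_hodgeGroup_le_weilSpecialUnitaryGroup (hα : α ∈ endAlgRat Φ)
    (hd : 0 < d) (hsq : α * α = -((d : ℚ) • 1)) (hn : 0 < n) (hE : finrank ℂ E = 2 * n)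
    {η : E [⋀^Fin 2]→L[ℝ] ℝ} (hη : ofRealForm η ∈ hodgeClasses Φ 1) :
    weilHodgeCycles Φ α d n ≤ hodgeClasses Φ n ↔ hodgeGroup Φ ≤ weilSpecialUnitaryGroup Φ η α d n := by
  rw [weilHodgeCycles_le_hodgeClasses_iff_isWeilType hα hd hsq hn hE,
    isWeilType_iff_hodgeGroup_le_weilSpecialUnitaryGroup hα hd hsq hn hE hη]

/-- For a torus of Weil type, `Hg(X)(ℝ)` fixes every Weil class. [cite: MoonenZarhin1998WeilClasses, Criterion (4) and (6)]
[cite: Lange2023AbelianVarietiesComplex, §7.2.2 Thm. 7.2.4 and §7.2.4 Exercise (9)] -/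
theorem IsWeilType.hodgeGroup_le_formsStabilizer_weilHodgeCycles (h : IsWeilType Φ α d n) :
    hodgeGroup Φ ≤ formsStabilizer Φ (weilHodgeCycles Φ α d n : Set (E [⋀^Fin (2 * n)]→L[ℝ] ℂ)) := by
  haveI := wkh_finiteDimensional_complex Φ
  exact (weilHodgeCycles_le_hodgeClasses_iff_hodgeGroup_le_formsStabilizer Φ α d n).1
    h.weilHodgeCycles_le_hodgeClasses

end Group

end ComplexTorus

end Literature.Geometry.Kaehler
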